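import Literature.Analysis.FluidPDE.PassiveVectorTensorForcedEnergy
import Literature.Analysis.FluidPDE.PassiveVectorTensorRestart
import Literature.Analysis.FluidPDE.PassiveVectorTensorTranslate
import HarnessLib

/-!
# Forced weak passive solenoidal vectors with a constant viscosity tensor: the space–time pairing
# identity, RESTART at an intermediate time from a trace datum, and TRANSLATION covariance

Analysis/FluidPDE proof-support file (everything proved; no definitions, no named facts): the kinematic
ports to the forced class `Torus.IsWeakTensorPassiveVectorForcedOn A T 𝔸 b g F w₀ w` of
`PassiveVectorTensorForced.lean` (`∂ₜw + (b·∇)w + A (w·∇)b + ∇π = 𝓛_𝔸 w + g + Σⱼ ∂ⱼ(F j)`, `∇·w = 0`,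
forcing `g, F j ∈ L²((0,T) × T^d)`) of the three unforced files
`PassiveVectorTensorSpaceTimePairing` / `PassiveVectorTensorRestart` / `PassiveVectorTensorTranslate`:

* `setIntegral_test_smul_spaceTime`, `ae_integral_inner_spaceTime_eq` — the weak formulation tested with
  `η(t) • Ψ(t,x)` and its a.e. du Bois-Reymond form: for a.e. `t`,
  `∫⟪w(t), Ψ(t)⟫ = ∫⟪w₀, Ψ(0)⟫ + ∫_{(0,t]} (∫(⟪w, ∂ₜΨ + (b·∇)Ψ + 𝓛_𝔸^*Ψ⟫ + A⟪b, (w·∇)Ψ⟫) + ∫(⟪g, Ψ⟫ − Σⱼ⟪F j, ∂ⱼΨ⟫))`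
  (DiPerna–Lions 1989, §II.1 (13)–(14); Temam 1997, Ch. II §3);
* `translate_time` — **restart**: for `0 ≤ σ < T` and a field `wσ` satisfying the forced trace identities at
  `σ` (which hold with `wσ = w(σ)` for a.e. `σ`, `PassiveVectorTensorForcedEnergy.ae_integral_inner_eq`),
  `t ↦ w(σ + t)` is a forced weak solution on `[0, T − σ)` along `b(σ + ·)`, forced by `g(σ + ·)`,
  `F j(σ + ·)`, from `wσ` (evolution property of the linear problem; DiPerna–Lions 1989 §II.1, Pazy 1983 §5.1);
* `translate` — **translation covariance**: `(t,x) ↦ w t (x + a)` is a forced weak solution along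
  `b t (x + a)`, forced by `g t (x + a)`, `F j t (x + a)`, from `w₀ (x + a)`.

Consumer: the window chain of the K1L one-level split (`stub_oneLevelL_IW`, route
`SolenoidalFractalHomogenisation`, cell `ad-ideate`, tenure rulings D24-6/D24-6′): each refresh window
restarts the conjugated / distorted cell problem from its trace.

## References

* R. J. DiPerna, P.-L. Lions, *Ordinary differential equations, transport theory and Sobolev spaces*,
  Invent. Math. 98 (1989), §II.1 (12)–(14), §II.3. [`DiPernaLions1989`]
* A. Pazy, *Semigroups of Linear Operators and Applications to PDE* (Springer 1983), Ch. 5 §5.1. [`Pazy1983`]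
* R. Temam, *Infinite-Dimensional Dynamical Systems in Mechanics and Physics*, 2nd ed. (Springer 1997),
  Ch. II §3.1–3.2, (3.2)–(3.5), Thm. 3.1. [`Temam1997`]
* L. Grafakos, *Classical Fourier Analysis*, 3rd ed. (Springer 2014), §3.1. [`Grafakos2014`]
-/

noncomputable section

open MeasureTheory Set Filter Function TopologicalSpace
open scoped ENNReal NNReal InnerProductSpace ContDiff

namespace Literature.Analysis.FluidPDE

namespace Torus

variable {d : Type*} [Fintype d] [DecidableEq d]

namespace IsWeakTensorPassiveVectorForcedOn

variable {A T : ℝ} {𝔸 : Visc4 d} {b g w : ℝ → UnitAddTorus d → EuclideanSpace ℝ d}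
  {F : d → ℝ → UnitAddTorus d → EuclideanSpace ℝ d} {w₀ wσ : UnitAddTorus d → EuclideanSpace ℝ d}
  {Ψ : ℝ → UnitAddTorus d → EuclideanSpace ℝ d}

/-! ## §1 The space–time pairing identity -/

/-- **The forced weak formulation tested with `η(t) • Ψ(t, x)`.** For a smooth compactly supported `η`
with `tsupport η ⊆ (−∞, T)` and a divergence-free space–time test field `Ψ` on `[0,T)`:
`∫_{(0,T)} (η' ∫⟪w, Ψ⟫ + η (∫(⟪w, ∂ₜΨ + (b·∇)Ψ + 𝓛_𝔸^*Ψ⟫ + A⟪b, (w·∇)Ψ⟫) + ∫(⟪g, Ψ⟫ − Σⱼ⟪F j, ∂ⱼΨ⟫))) + η(0) ∫⟪w₀, Ψ(0)⟫ = 0`.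
[cite: DiPernaLions1989, §II.1 (13)–(14)] [cite: Temam1997, Ch. II §3.1–3.2, (3.2)–(3.5), Thm. 3.1] -/
theorem setIntegral_test_smul_spaceTime (h : IsWeakTensorPassiveVectorForcedOn A T 𝔸 b g F w₀ w) {η : ℝ → ℝ}
    (hη : ContDiff ℝ ∞ η) (hηc : HasCompactSupport η) (hηT : tsupport η ⊆ Iio T)
    (hΨ : FunctionSpaces.Torus.IsSpaceTimeTest T Ψ) (hΨdiv : ∀ t, FunctionSpaces.Torus.IsDivFree (Ψ t)) :
    (∫ t in Ioo 0 T, ((deriv η t * ∫ x, ⟪w t x, Ψ t x⟫_ℝ) +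
      η t * ((∫ x, (⟪w t x, FunctionSpaces.Torus.timeDeriv Ψ t x +
          FunctionSpaces.Torus.convect (b t) (Ψ t) x + viscAdj 𝔸 (Ψ t) x⟫_ℝ +
        A * ⟪b t x, FunctionSpaces.Torus.convect (w t) (Ψ t) x⟫_ℝ)) +
        ∫ x, (⟪g t x, Ψ t x⟫_ℝ - ∑ j, ⟪F j t x, FunctionSpaces.Torus.partialDeriv j (Ψ t) x⟫_ℝ)))) +
      η 0 * ∫ x, ⟪w₀ x, Ψ 0 x⟫_ℝ = 0 := by
  have _ := hηT
  have _ := hηc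
  have hΨ' := isSpaceTimeTest_smul_spaceTime hη hΨ
  have hΨ1 : ∀ t, FunctionSpaces.Torus.IsContDiff 1 (Ψ t) := fun t => (hΨ.isSmooth_slice t).isContDiff (by simp)
  have hΨ'div : ∀ t, FunctionSpaces.Torus.IsDivFree ((fun t x => η t • Ψ t x) t) := fun t => by
    rw [show ((fun t x => η t • Ψ t x) t) = η t • Ψ t from rfl]
    exact isDivFree_const_smul_field (hΨdiv t) (η t)
  have key := h.integral_prod_weak_eq hΨ' hΨ'div
  set P : Measure (ℝ × UnitAddTorus d) := ((volume : Measure ℝ).restrict (Ioo 0 T)).prod volume with hP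
  -- pointwise form of the unforced integrand
  have hpt : ∀ p : ℝ × UnitAddTorus d,
      ⟪w p.1 p.2, FunctionSpaces.Torus.timeDeriv (fun t x => η t • Ψ t x) p.1 p.2 +
          FunctionSpaces.Torus.convect (b p.1) ((fun t x => η t • Ψ t x) p.1) p.2 +
          viscAdj 𝔸 ((fun t x => η t • Ψ t x) p.1) p.2⟫_ℝ +
        A * ⟪b p.1 p.2, FunctionSpaces.Torus.convect (w p.1) ((fun t x => η t • Ψ t x) p.1) p.2⟫_ℝ =
      deriv η p.1 * ⟪w p.1 p.2, Ψ p.1 p.2⟫_ℝ +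
        η p.1 * (⟪w p.1 p.2, FunctionSpaces.Torus.timeDeriv Ψ p.1 p.2 +
            FunctionSpaces.Torus.convect (b p.1) (Ψ p.1) p.2 + viscAdj 𝔸 (Ψ p.1) p.2⟫_ℝ +
          A * ⟪b p.1 p.2, FunctionSpaces.Torus.convect (w p.1) (Ψ p.1) p.2⟫_ℝ) := by
    intro p
    rw [timeDeriv_smul_spaceTime hη hΨ,
      show (fun t x => η t • Ψ t x) p.1 = η p.1 • Ψ p.1 from rfl,
      convect_const_smul_field (hΨ1 p.1), convect_const_smul_field (hΨ1 p.1),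
      viscAdj_const_smul_field 𝔸 (hΨ.isSmooth_slice p.1)]
    simp only [inner_add_right, inner_smul_right]
    ring
  -- pointwise form of the forcing integrand
  have hptF : ∀ p : ℝ × UnitAddTorus d,
      ⟪g p.1 p.2, (fun t x => η t • Ψ t x) p.1 p.2⟫_ℝ -
          ∑ j, ⟪F j p.1 p.2, FunctionSpaces.Torus.partialDeriv j ((fun t x => η t • Ψ t x) p.1) p.2⟫_ℝ =
        η p.1 * (⟪g p.1 p.2, Ψ p.1 p.2⟫_ℝ -
          ∑ j, ⟪F j p.1 p.2, FunctionSpaces.Torus.partialDeriv j (Ψ p.1) p.2⟫_ℝ) := by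
    intro p
    show ⟪g p.1 p.2, η p.1 • Ψ p.1 p.2⟫_ℝ -
        ∑ j, ⟪F j p.1 p.2, FunctionSpaces.Torus.partialDeriv j (η p.1 • Ψ p.1) p.2⟫_ℝ = _
    simp only [FunctionSpaces.Torus.partialDeriv_const_smul (hΨ1 p.1), Pi.smul_apply, real_inner_smul_right]
    rw [mul_sub, Finset.mul_sum]
  obtain ⟨Ca, hCa⟩ := (hη.continuous_deriv (by simp)).bounded_above_of_compact_support hηc.deriv
  obtain ⟨Cb, hCb⟩ := hη.continuous.bounded_above_of_compact_support hηc
  set f₁ : ℝ × UnitAddTorus d → ℝ := fun p => deriv η p.1 * ⟪w p.1 p.2, Ψ p.1 p.2⟫_ℝ with hf₁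
  set f₂ : ℝ × UnitAddTorus d → ℝ := fun p =>
    η p.1 * (⟪w p.1 p.2, FunctionSpaces.Torus.timeDeriv Ψ p.1 p.2 +
        FunctionSpaces.Torus.convect (b p.1) (Ψ p.1) p.2 + viscAdj 𝔸 (Ψ p.1) p.2⟫_ℝ +
      A * ⟪b p.1 p.2, FunctionSpaces.Torus.convect (w p.1) (Ψ p.1) p.2⟫_ℝ) with hf₂
  set f₃ : ℝ × UnitAddTorus d → ℝ := fun p =>
    η p.1 * (⟪g p.1 p.2, Ψ p.1 p.2⟫_ℝ -
      ∑ j, ⟪F j p.1 p.2, FunctionSpaces.Torus.partialDeriv j (Ψ p.1) p.2⟫_ℝ) with hf₃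
  have hΨc : Continuous (uncurry Ψ) := FunctionSpaces.Torus.continuous_uncurry_of_continuous_stLift hΨ.1.continuous
  have hI₁ := h.integrable_inner_of_continuous hΨc
  have hI₂ := h.integrable_weakIntegrand hΨ
  have hI₃ := h.integrable_forceIntegrand hΨ
  have hf₁i : Integrable f₁ P :=
    hI₁.bdd_mul ((hη.continuous_deriv (by simp)).comp continuous_fst).aestronglyMeasurable
      (Eventually.of_forall fun p => hCa p.1)
  have hf₂i : Integrable f₂ P :=
    hI₂.bdd_mul (hη.continuous.comp continuous_fst).aestronglyMeasurable (Eventually.of_forall fun p => hCb p.1)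
  have hf₃i : Integrable f₃ P :=
    hI₃.bdd_mul (hη.continuous.comp continuous_fst).aestronglyMeasurable (Eventually.of_forall fun p => hCb p.1)
  have esum : (∫ p, (f₁ p + f₂ p) ∂P) + (∫ p, f₃ p ∂P) + η 0 * ∫ x, ⟪w₀ x, Ψ 0 x⟫_ℝ = 0 := by
    have e1 : ∫ p, (f₁ p + f₂ p) ∂P = ∫ p,
        (⟪w p.1 p.2, FunctionSpaces.Torus.timeDeriv (fun t x => η t • Ψ t x) p.1 p.2 +
            FunctionSpaces.Torus.convect (b p.1) ((fun t x => η t • Ψ t x) p.1) p.2 +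
            viscAdj 𝔸 ((fun t x => η t • Ψ t x) p.1) p.2⟫_ℝ +
          A * ⟪b p.1 p.2, FunctionSpaces.Torus.convect (w p.1) ((fun t x => η t • Ψ t x) p.1) p.2⟫_ℝ) ∂P := by
      refine integral_congr_ae (Eventually.of_forall fun p => ?_)
      simp only [hf₁, hf₂]
      exact (hpt p).symm
    have e3 : ∫ p, f₃ p ∂P = ∫ p,
        (⟪g p.1 p.2, (fun t x => η t • Ψ t x) p.1 p.2⟫_ℝ -
          ∑ j, ⟪F j p.1 p.2, FunctionSpaces.Torus.partialDeriv j ((fun t x => η t • Ψ t x) p.1) p.2⟫_ℝ) ∂P := by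
      refine integral_congr_ae (Eventually.of_forall fun p => ?_)
      simp only [hf₃]
      exact (hptF p).symm
    have e2 : η 0 * ∫ x, ⟪w₀ x, Ψ 0 x⟫_ℝ = ∫ x, ⟪w₀ x, (fun t x => η t • Ψ t x) 0 x⟫_ℝ := by
      rw [← integral_const_mul]
      exact integral_congr_ae (Eventually.of_forall fun x => by simp only [inner_smul_right])
    rw [e1, e2, e3]
    exact key
  have e₁ : ∫ p, f₁ p ∂P = ∫ t in Ioo 0 T, deriv η t * ∫ x, ⟪w t x, Ψ t x⟫_ℝ := by
    rw [hP, integral_prod _ hf₁i]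
    refine integral_congr_ae (Eventually.of_forall fun t => ?_)
    simp only [hf₁]
    exact integral_const_mul _ _
  have e₂ : ∫ p, f₂ p ∂P = ∫ t in Ioo 0 T, η t * ∫ x, (⟪w t x, FunctionSpaces.Torus.timeDeriv Ψ t x +
        FunctionSpaces.Torus.convect (b t) (Ψ t) x + viscAdj 𝔸 (Ψ t) x⟫_ℝ +
      A * ⟪b t x, FunctionSpaces.Torus.convect (w t) (Ψ t) x⟫_ℝ) := by
    rw [hP, integral_prod _ hf₂i]
    refine integral_congr_ae (Eventually.of_forall fun t => ?_)
    simp only [hf₂]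
    exact integral_const_mul _ _
  have e₃ : ∫ p, f₃ p ∂P = ∫ t in Ioo 0 T, η t *
      ∫ x, (⟪g t x, Ψ t x⟫_ℝ - ∑ j, ⟪F j t x, FunctionSpaces.Torus.partialDeriv j (Ψ t) x⟫_ℝ) := by
    rw [hP, integral_prod _ hf₃i]
    refine integral_congr_ae (Eventually.of_forall fun t => ?_)
    simp only [hf₃]
    exact integral_const_mul _ _
  have ha : Integrable (fun t => deriv η t * ∫ x, ⟪w t x, Ψ t x⟫_ℝ) (volume.restrict (Ioo 0 T)) := by
    refine hf₁i.integral_prod_left.congr (Eventually.of_forall fun t => ?_)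
    simp only [hf₁]
    exact integral_const_mul _ _
  have hb : Integrable (fun t => η t * ∫ x, (⟪w t x, FunctionSpaces.Torus.timeDeriv Ψ t x +
        FunctionSpaces.Torus.convect (b t) (Ψ t) x + viscAdj 𝔸 (Ψ t) x⟫_ℝ +
      A * ⟪b t x, FunctionSpaces.Torus.convect (w t) (Ψ t) x⟫_ℝ)) (volume.restrict (Ioo 0 T)) := by
    refine hf₂i.integral_prod_left.congr (Eventually.of_forall fun t => ?_)
    simp only [hf₂]
    exact integral_const_mul _ _
  have hc : Integrable (fun t => η t *
      ∫ x, (⟪g t x, Ψ t x⟫_ℝ - ∑ j, ⟪F j t x, FunctionSpaces.Torus.partialDeriv j (Ψ t) x⟫_ℝ))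
      (volume.restrict (Ioo 0 T)) := by
    refine hf₃i.integral_prod_left.congr (Eventually.of_forall fun t => ?_)
    simp only [hf₃]
    exact integral_const_mul _ _
  rw [integral_add hf₁i hf₂i, e₁, e₂, e₃] at esum
  have esplit : ∀ t, (deriv η t * ∫ x, ⟪w t x, Ψ t x⟫_ℝ) +
      η t * ((∫ x, (⟪w t x, FunctionSpaces.Torus.timeDeriv Ψ t x +
          FunctionSpaces.Torus.convect (b t) (Ψ t) x + viscAdj 𝔸 (Ψ t) x⟫_ℝ +
        A * ⟪b t x, FunctionSpaces.Torus.convect (w t) (Ψ t) x⟫_ℝ)) +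
        ∫ x, (⟪g t x, Ψ t x⟫_ℝ - ∑ j, ⟪F j t x, FunctionSpaces.Torus.partialDeriv j (Ψ t) x⟫_ℝ)) =
      ((deriv η t * ∫ x, ⟪w t x, Ψ t x⟫_ℝ) +
        η t * ∫ x, (⟪w t x, FunctionSpaces.Torus.timeDeriv Ψ t x +
          FunctionSpaces.Torus.convect (b t) (Ψ t) x + viscAdj 𝔸 (Ψ t) x⟫_ℝ +
        A * ⟪b t x, FunctionSpaces.Torus.convect (w t) (Ψ t) x⟫_ℝ)) +
        η t * ∫ x, (⟪g t x, Ψ t x⟫_ℝ - ∑ j, ⟪F j t x, FunctionSpaces.Torus.partialDeriv j (Ψ t) x⟫_ℝ) :=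
    fun t => by ring
  have hab : Integrable (fun t => (deriv η t * ∫ x, ⟪w t x, Ψ t x⟫_ℝ) +
      η t * ∫ x, (⟪w t x, FunctionSpaces.Torus.timeDeriv Ψ t x +
          FunctionSpaces.Torus.convect (b t) (Ψ t) x + viscAdj 𝔸 (Ψ t) x⟫_ℝ +
        A * ⟪b t x, FunctionSpaces.Torus.convect (w t) (Ψ t) x⟫_ℝ)) (volume.restrict (Ioo 0 T)) := ha.add hb
  simp_rw [esplit]
  rw [integral_add hab hc, integral_add ha hb]
  linarith

/-- **A forced weak solution paired with a divergence-free space–time test field is absolutely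
continuous in time**: for a.e. `t ∈ (0,T)`,
`∫⟪w(t), Ψ(t)⟫ = ∫⟪w₀, Ψ(0)⟫ + ∫_{(0,t]} (∫(⟪w, ∂ₜΨ + (b·∇)Ψ + 𝓛_𝔸^*Ψ⟫ + A⟪b, (w·∇)Ψ⟫) + ∫(⟪g, Ψ⟫ − Σⱼ⟪F j, ∂ⱼΨ⟫)) dτ`.
[cite: DiPernaLions1989, §II.1 (13)–(14)] [cite: Temam1997, Ch. II §3.1–3.2, (3.2)–(3.5), Thm. 3.1] -/
theorem ae_integral_inner_spaceTime_eq (h : IsWeakTensorPassiveVectorForcedOn A T 𝔸 b g F w₀ w)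
    (hΨ : FunctionSpaces.Torus.IsSpaceTimeTest T Ψ) (hΨdiv : ∀ t, FunctionSpaces.Torus.IsDivFree (Ψ t)) :
    ∀ᵐ t ∂(volume.restrict (Ioo 0 T)),
      ∫ x, ⟪w t x, Ψ t x⟫_ℝ = (∫ x, ⟪w₀ x, Ψ 0 x⟫_ℝ) +
        ∫ τ in Ioc 0 t, ((∫ x, (⟪w τ x, FunctionSpaces.Torus.timeDeriv Ψ τ x +
            FunctionSpaces.Torus.convect (b τ) (Ψ τ) x + viscAdj 𝔸 (Ψ τ) x⟫_ℝ +
          A * ⟪b τ x, FunctionSpaces.Torus.convect (w τ) (Ψ τ) x⟫_ℝ)) +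
          ∫ x, (⟪g τ x, Ψ τ x⟫_ℝ - ∑ j, ⟪F j τ x, FunctionSpaces.Torus.partialDeriv j (Ψ τ) x⟫_ℝ)) := by
  have hΨc : Continuous (uncurry Ψ) := FunctionSpaces.Torus.continuous_uncurry_of_continuous_stLift hΨ.1.continuous
  have hU : IntegrableOn (fun t => ∫ x, ⟪w t x, Ψ t x⟫_ℝ) (Ioo 0 T) volume :=
    (h.integrable_inner_of_continuous hΨc).integral_prod_left
  have hF : IntegrableOn (fun t => (∫ x, (⟪w t x, FunctionSpaces.Torus.timeDeriv Ψ t x +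
        FunctionSpaces.Torus.convect (b t) (Ψ t) x + viscAdj 𝔸 (Ψ t) x⟫_ℝ +
      A * ⟪b t x, FunctionSpaces.Torus.convect (w t) (Ψ t) x⟫_ℝ)) +
      ∫ x, (⟪g t x, Ψ t x⟫_ℝ - ∑ j, ⟪F j t x, FunctionSpaces.Torus.partialDeriv j (Ψ t) x⟫_ℝ)) (Ioo 0 T) volume :=
    (h.integrable_weakIntegrand hΨ).integral_prod_left.add (h.integrable_forceIntegrand hΨ).integral_prod_left
  exact FunctionSpaces.ae_eq_add_setIntegral_of_forall_test hU hF fun η hη hηc hηT =>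
    h.setIntegral_test_smul_spaceTime hη hηc hηT hΨ hΨdiv

/-! ## §2 Restart from a trace datum -/

/-- **Restart at an intermediate time from the trace (time translation), forced class.** Let `w` be a
forced weak solution on `T^d × [0,T)` from `w₀`, let `0 ≤ σ < T`, and let `wσ` satisfy the forced trace
identities at `σ`: for every smooth divergence-free steady `G`,
`∫⟪wσ, G⟫ = ∫⟪w₀, G⟫ + ∫_{(0,σ]} ((∫⟪w, (b·∇)G + 𝓛_𝔸^*G⟫ + A∫⟪b, (w·∇)G⟫) + (∫⟪g, G⟫ − Σⱼ ∫⟪F j, ∂ⱼG⟫)) dτ`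
(true with `wσ = w(σ)` for a.e. `σ`, `ae_integral_inner_eq`). Then `t ↦ w(σ + t)` is a forced weak
solution on `T^d × [0, T − σ)` along `b(σ + ·)`, forced by `g(σ + ·)` and `F j(σ + ·)`, with the same tensor
and coupling, from the datum `wσ` (the evolution property of the linear problem).
[cite: DiPernaLions1989, §II.1 (12)–(14)] [cite: Pazy1983, Ch. 5 §5.1] -/
theorem translate_time (h : IsWeakTensorPassiveVectorForcedOn A T 𝔸 b g F w₀ w) {σ : ℝ} (hσ : 0 ≤ σ) (hσT : σ < T)
    (htr : ∀ G : UnitAddTorus d → EuclideanSpace ℝ d, FunctionSpaces.Torus.IsSmooth G →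
      FunctionSpaces.Torus.IsDivFree G →
      ∫ x, ⟪wσ x, G x⟫_ℝ = (∫ x, ⟪w₀ x, G x⟫_ℝ) +
        ∫ τ in Ioc 0 σ, (((∫ x, ⟪w τ x, FunctionSpaces.Torus.convect (b τ) G x + viscAdj 𝔸 G x⟫_ℝ) +
          A * ∫ x, ⟪b τ x, FunctionSpaces.Torus.convect (w τ) G x⟫_ℝ) +
          ((∫ x, ⟪g τ x, G x⟫_ℝ) - ∑ j, ∫ x, ⟪F j τ x, FunctionSpaces.Torus.partialDeriv j G x⟫_ℝ))) :
    IsWeakTensorPassiveVectorForcedOn A (T - σ) 𝔸 (fun t => b (σ + t)) (fun t => g (σ + t))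
      (fun j t => F j (σ + t)) wσ (fun t => w (σ + t)) := by
  have hTT : σ + (T - σ) ≤ T := by linarith
  have hT : 0 < T := hσ.trans_lt hσT
  obtain ⟨C, hC⟩ := h.ae_lintegral_sq_le
  refine ⟨?_, ?_, ⟨C, ae_restrict_Ioo_comp_add_left hC hσ hTT⟩, ?_, ?_,
    ae_restrict_Ioo_comp_add_left h.ae_isWeaklyDivFree_carrier hσ hTT,
    ae_restrict_Ioo_comp_add_left h.ae_isWeaklyDivFree hσ hTT, ?_, ?_, fun j => ?_, fun j => ?_, ?_⟩
  · exact FunctionSpaces.Torus.aestronglyMeasurable_stLift_of_uncurry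
      (aestronglyMeasurable_uncurry_comp_add_left h.aestronglyMeasurable_uncurry hσ hTT)
  · exact FunctionSpaces.Torus.aestronglyMeasurable_stLift_of_uncurry
      (aestronglyMeasurable_uncurry_comp_add_left h.aestronglyMeasurable_uncurry_carrier hσ hTT)
  · exact (setLIntegral_comp_add_left_le (F := fun t => (∫⁻ x, ‖b t x‖ₑ ^ 2) ^ (1 / 2 : ℝ)) hσ hTT).trans_lt
      h.lintegral_carrier_lt_top
  · exact (setLIntegral_comp_add_left_le (F := fun t => ∫⁻ x, ‖b t x‖ₑ * ‖w t x‖ₑ) hσ hTT).trans_lt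
      h.lintegral_mul_lt_top
  · exact FunctionSpaces.Torus.aestronglyMeasurable_stLift_of_uncurry
      (aestronglyMeasurable_uncurry_comp_add_left h.aestronglyMeasurable_uncurry_force hσ hTT)
  · exact (setLIntegral_comp_add_left_le (F := fun t => ∫⁻ x, ‖g t x‖ₑ ^ 2) hσ hTT).trans_lt
      h.lintegral_force_sq_lt_top
  · exact FunctionSpaces.Torus.aestronglyMeasurable_stLift_of_uncurry
      (aestronglyMeasurable_uncurry_comp_add_left (h.aestronglyMeasurable_uncurry_flux j) hσ hTT)
  · exact (setLIntegral_comp_add_left_le (F := fun t => ∫⁻ x, ‖F j t x‖ₑ ^ 2) hσ hTT).trans_lt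
      (h.lintegral_flux_sq_lt_top j)
  -- the weak formulation
  intro Ψ hΨ hΨdiv
  set Ψσ : ℝ → UnitAddTorus d → EuclideanSpace ℝ d := fun t x => Ψ (t - σ) x with hΨσ_def
  have hΨσ : FunctionSpaces.Torus.IsSpaceTimeTest T Ψσ := isSpaceTimeTest_time_shift hΨ
  have hΨσdiv : ∀ t, FunctionSpaces.Torus.IsDivFree (Ψσ t) := fun t => hΨdiv (t - σ)
  have hΨσ_shift : ∀ t, Ψσ (σ + t) = Ψ t := fun t => by
    funext x; simp only [hΨσ_def, add_sub_cancel_left]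
  have hΨσ_σ : Ψσ σ = Ψ 0 := by
    have := hΨσ_shift 0; rwa [add_zero] at this
  -- the weak integrand and the work integrand of the shifted test, as functions of time
  set Aw : ℝ → ℝ := fun t => ∫ x, (⟪w t x, FunctionSpaces.Torus.timeDeriv Ψσ t x +
      FunctionSpaces.Torus.convect (b t) (Ψσ t) x + viscAdj 𝔸 (Ψσ t) x⟫_ℝ +
    A * ⟪b t x, FunctionSpaces.Torus.convect (w t) (Ψσ t) x⟫_ℝ) with hAw_def
  set Bw : ℝ → ℝ := fun t => ∫ x, (⟪g t x, Ψσ t x⟫_ℝ -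
      ∑ j, ⟪F j t x, FunctionSpaces.Torus.partialDeriv j (Ψσ t) x⟫_ℝ) with hBw_def
  have hAw_shift : ∀ t, Aw (σ + t) = ∫ x, (⟪w (σ + t) x, FunctionSpaces.Torus.timeDeriv Ψ t x +
      FunctionSpaces.Torus.convect (b (σ + t)) (Ψ t) x + viscAdj 𝔸 (Ψ t) x⟫_ℝ +
    A * ⟪b (σ + t) x, FunctionSpaces.Torus.convect (w (σ + t)) (Ψ t) x⟫_ℝ) := by
    intro t
    simp only [hAw_def, hΨσ_shift t]
    refine integral_congr_ae (Eventually.of_forall fun x => ?_)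
    have e : FunctionSpaces.Torus.timeDeriv Ψσ (σ + t) x = FunctionSpaces.Torus.timeDeriv Ψ t x := by
      rw [hΨσ_def, timeDeriv_time_shift, add_sub_cancel_left]
    simp only [e]
  have hBw_shift : ∀ t, Bw (σ + t) = ∫ x, (⟪g (σ + t) x, Ψ t x⟫_ℝ -
      ∑ j, ⟪F j (σ + t) x, FunctionSpaces.Torus.partialDeriv j (Ψ t) x⟫_ℝ) := by
    intro t
    simp only [hBw_def, hΨσ_shift t]
  have hAint : IntegrableOn Aw (Ioo 0 T) volume := (h.integrable_weakIntegrand hΨσ).integral_prod_left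
  have hBint : IntegrableOn Bw (Ioo 0 T) volume := (h.integrable_forceIntegrand hΨσ).integral_prod_left
  set S : ℝ → ℝ := fun t => Aw t + Bw t with hS_def
  have hSint : IntegrableOn S (Ioo 0 T) volume := hAint.add hBint
  -- (1) the weak formulation of `w` tested with `Ψσ`
  have hweak : (∫ t in Ioo 0 T, S t) + ∫ x, ⟪w₀ x, Ψσ 0 x⟫_ℝ = 0 := by
    have h1 := h.weak_eq Ψσ hΨσ hΨσdiv
    have e : ∫ t in Ioo 0 T, S t = (∫ t in Ioo 0 T, Aw t) + ∫ t in Ioo 0 T, Bw t := integral_add hAint hBint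
    rw [e]
    exact h1
  -- (2) splitting the time integral at `σ`
  have hsplit : ∫ t in Ioo 0 T, S t = (∫ t in Ioc 0 σ, S t) + ∫ t in Ioo σ T, S t := by
    have hF' : IntegrableOn S (Ioc 0 T) volume := hSint.congr_set_ae Ioo_ae_eq_Ioc.symm
    have h1 : IntervalIntegrable S volume 0 σ :=
      (intervalIntegrable_iff_integrableOn_Ioc_of_le hσ).2 (hF'.mono_set (Ioc_subset_Ioc_right hσT.le))
    have h2 : IntervalIntegrable S volume σ T :=
      (intervalIntegrable_iff_integrableOn_Ioc_of_le hσT.le).2 (hF'.mono_set (Ioc_subset_Ioc_left hσ))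
    rw [← integral_Ioc_eq_integral_Ioo (x := (0 : ℝ)) (y := T), ← integral_Ioc_eq_integral_Ioo (x := σ) (y := T),
      ← intervalIntegral.integral_of_le hT.le, ← intervalIntegral.integral_of_le hσ,
      ← intervalIntegral.integral_of_le hσT.le]
    exact (intervalIntegral.integral_add_adjacent_intervals h1 h2).symm
  -- (3) the absolutely continuous representatives
  set Q : ℝ → ℝ := fun t => (∫ x, ⟪w₀ x, Ψσ 0 x⟫_ℝ) + ∫ τ in Ioc 0 t, S τ with hQ_def
  have hG : FunctionSpaces.Torus.IsSmooth (Ψ 0) := hΨ.isSmooth_slice 0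
  have hGdiv : FunctionSpaces.Torus.IsDivFree (Ψ 0) := hΨdiv 0
  set Fst : ℝ → ℝ := fun τ => ((∫ x, ⟪w τ x, FunctionSpaces.Torus.convect (b τ) (Ψ 0) x + viscAdj 𝔸 (Ψ 0) x⟫_ℝ) +
      A * ∫ x, ⟪b τ x, FunctionSpaces.Torus.convect (w τ) (Ψ 0) x⟫_ℝ) +
      ((∫ x, ⟪g τ x, Ψ 0 x⟫_ℝ) - ∑ j, ∫ x, ⟪F j τ x, FunctionSpaces.Torus.partialDeriv j (Ψ 0) x⟫_ℝ)
    with hFst_def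
  have hFst : IntegrableOn Fst (Ioo 0 T) volume := (h.integrableOn_steadyRHS hG).add (h.integrableOn_forceRHS hG)
  set P : ℝ → ℝ := fun t => (∫ x, ⟪w₀ x, Ψ 0 x⟫_ℝ) + ∫ τ in Ioc 0 t, Fst τ with hP_def
  have hQc : ContinuousOn Q (Icc 0 T) :=
    continuousOn_const.add (intervalIntegral.continuousOn_primitive (hSint.congr_set_ae Ioo_ae_eq_Icc.symm))
  have hPc : ContinuousOn P (Icc 0 T) :=
    continuousOn_const.add (intervalIntegral.continuousOn_primitive (hFst.congr_set_ae Ioo_ae_eq_Icc.symm))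
  have hQae : ∀ᵐ t ∂(volume.restrict (Ioo 0 T)), ∫ x, ⟪w t x, Ψσ t x⟫_ℝ = Q t := by
    filter_upwards [h.ae_integral_inner_spaceTime_eq hΨσ hΨσdiv] with t ht
    simpa only [hQ_def, hS_def, hAw_def, hBw_def] using ht
  have hPae : ∀ᵐ t ∂(volume.restrict (Ioo 0 T)), ∫ x, ⟪w t x, Ψ 0 x⟫_ℝ = P t := by
    filter_upwards [h.ae_integral_inner_eq hG hGdiv] with t ht
    simpa only [hP_def, hFst_def] using ht
  -- (4) `Q σ = P σ`
  obtain ⟨L, hL0, hL⟩ := exists_lipschitz_time_of_isSpaceTimeTest (T' := T) hΨσ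
  obtain ⟨C₁, hC₁⟩ := h.exists_eLpNorm_le
  have hGc : Continuous (Ψ 0) := hG.continuous
  have hbound : ∀ᵐ t ∂(volume.restrict (Ioo 0 T)), |Q t - P t| - (C₁ : ℝ) * L * |t - σ| ≤ 0 := by
    filter_upwards [hQae, hPae, h.ae_integrable_slice, hC₁, h.ae_memLp_two, ae_restrict_mem measurableSet_Ioo]
      with t htQ htP hti ht₁ htm htI
    have hwi : Integrable (w t) volume := hti.1
    have htIcc : t ∈ Icc 0 T := Ioo_subset_Icc_self htI
    have hσIcc : σ ∈ Icc 0 T := ⟨hσ, hσT.le⟩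
    have hΨc : Continuous (Ψσ t) := (hΨσ.isSmooth_slice t).continuous
    have i1 : Integrable (fun x => ⟪w t x, Ψσ t x⟫_ℝ) volume := FunctionSpaces.Torus.integrable_inner_of_continuous hwi hΨc
    have i2 : Integrable (fun x => ⟪w t x, Ψ 0 x⟫_ℝ) volume := FunctionSpaces.Torus.integrable_inner_of_continuous hwi hGc
    have hdiff : Q t - P t = ∫ x, ⟪w t x, Ψσ t x - Ψ 0 x⟫_ℝ := by
      rw [← htQ, ← htP, ← integral_sub i1 i2]
      exact integral_congr_ae (Eventually.of_forall fun x => by simp only [inner_sub_right])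
    have hL1 : ∫ x, ‖w t x‖ ≤ (C₁ : ℝ) := by
      have e1 : ∫ x, ‖w t x‖ = (∫⁻ x, ‖w t x‖ₑ).toReal := by
        rw [← integral_norm_eq_lintegral_enorm hwi.aestronglyMeasurable]
      have e2 : ∫⁻ x, ‖w t x‖ₑ = eLpNorm (w t) 1 volume := by rw [eLpNorm_one_eq_lintegral_enorm]
      rw [e1, e2]
      have h12 : eLpNorm (w t) 1 volume ≤ C₁ :=
        (eLpNorm_le_eLpNorm_of_exponent_le (by norm_num) htm.1).trans ht₁
      have := ENNReal.toReal_mono ENNReal.coe_ne_top h12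
      simpa using this
    have hpt : ∀ x, ‖⟪w t x, Ψσ t x - Ψ 0 x⟫_ℝ‖ ≤ L * |t - σ| * ‖w t x‖ := by
      intro x
      refine (norm_inner_le_norm _ _).trans ?_
      rw [mul_comm]
      refine mul_le_mul_of_nonneg_right ?_ (norm_nonneg _)
      have := hL t htIcc σ hσIcc x
      rwa [hΨσ_σ] at this
    have hest : |Q t - P t| ≤ (C₁ : ℝ) * L * |t - σ| := by
      rw [hdiff, ← Real.norm_eq_abs]
      calc ‖∫ x, ⟪w t x, Ψσ t x - Ψ 0 x⟫_ℝ‖ ≤ ∫ x, ‖⟪w t x, Ψσ t x - Ψ 0 x⟫_ℝ‖ := norm_integral_le_integral_norm _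
        _ ≤ ∫ x, L * |t - σ| * ‖w t x‖ :=
            integral_mono_of_nonneg (Eventually.of_forall fun x => norm_nonneg _)
              (hwi.norm.const_mul _) (Eventually.of_forall hpt)
        _ = L * |t - σ| * ∫ x, ‖w t x‖ := integral_const_mul _ _
        _ ≤ L * |t - σ| * C₁ := mul_le_mul_of_nonneg_left hL1 (by positivity)
        _ = (C₁ : ℝ) * L * |t - σ| := by ring
    linarith
  have hcont : ContinuousOn (fun t => |Q t - P t| - (C₁ : ℝ) * L * |t - σ|) (Icc 0 T) :=
    ((hQc.sub hPc).abs).sub (continuousOn_const.mul ((continuousOn_id.sub continuousOn_const).abs))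
  have hQP : Q σ = P σ := by
    have h0 := le_on_Icc_of_ae_le_of_continuousOn hT hcont hbound σ ⟨hσ, hσT.le⟩
    simp only [sub_self, abs_zero, mul_zero, sub_zero] at h0
    have : |Q σ - P σ| = 0 := le_antisymm h0 (abs_nonneg _)
    rwa [abs_eq_zero, sub_eq_zero] at this
  -- (5) the trace identity
  have hPσ : P σ = ∫ x, ⟪wσ x, Ψ 0 x⟫_ℝ := by
    rw [htr (Ψ 0) hG hGdiv]
  -- (6) assembling and changing variables `t = σ + τ`
  have hIσT : ∫ t in Ioo σ T, S t = -∫ x, ⟪wσ x, Ψ 0 x⟫_ℝ := by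
    have e : Q σ = (∫ x, ⟪w₀ x, Ψσ 0 x⟫_ℝ) + ∫ τ in Ioc 0 σ, S τ := rfl
    rw [← hPσ, ← hQP]
    linarith [hweak, hsplit, e]
  have hcv : ∫ t in Ioo 0 (T - σ), S (σ + t) = ∫ t in Ioo σ T, S t := by
    have := setIntegral_time_shift S σ (T - σ)
    rwa [add_sub_cancel] at this
  have hAσ : IntegrableOn (fun t => Aw (σ + t)) (Ioo 0 (T - σ)) volume := integrableOn_time_shift hAint hσ hTT
  have hBσ : IntegrableOn (fun t => Bw (σ + t)) (Ioo 0 (T - σ)) volume := integrableOn_time_shift hBint hσ hTT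
  have hSe : ∫ t in Ioo 0 (T - σ), S (σ + t) = (∫ t in Ioo 0 (T - σ), Aw (σ + t)) + ∫ t in Ioo 0 (T - σ), Bw (σ + t) :=
    integral_add hAσ hBσ
  have hAe : ∫ t in Ioo 0 (T - σ), Aw (σ + t) =
      ∫ t in Ioo 0 (T - σ), ∫ x, (⟪w (σ + t) x, FunctionSpaces.Torus.timeDeriv Ψ t x +
          FunctionSpaces.Torus.convect (b (σ + t)) (Ψ t) x + viscAdj 𝔸 (Ψ t) x⟫_ℝ +
        A * ⟪b (σ + t) x, FunctionSpaces.Torus.convect (w (σ + t)) (Ψ t) x⟫_ℝ) :=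
    setIntegral_congr_fun measurableSet_Ioo fun t _ => hAw_shift t
  have hBe : ∫ t in Ioo 0 (T - σ), Bw (σ + t) =
      ∫ t in Ioo 0 (T - σ), ∫ x, (⟪g (σ + t) x, Ψ t x⟫_ℝ -
        ∑ j, ⟪F j (σ + t) x, FunctionSpaces.Torus.partialDeriv j (Ψ t) x⟫_ℝ) :=
    setIntegral_congr_fun measurableSet_Ioo fun t _ => hBw_shift t
  rw [← hAe, ← hBe, ← hSe, hcv, hIσT]
  ring

/-! ## §3 Translation covariance -/

/-- **Translation covariance of forced weak tensor-viscosity passive-vector solutions.** If `w` is a forced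
weak solution along `b`, forced by `g` and the flux columns `F j`, from `w₀`, then for every `a ∈ T^d` the
translate `(t, x) ↦ w t (x + a)` is a forced weak solution along `(t,x) ↦ b t (x + a)`, forced by
`g t (x + a)`, `F j t (x + a)`, from `x ↦ w₀ (x + a)` (Haar measure is translation invariant; the constant
tensor and every differential operator of the weak formulation commute with translations; the test class is
translation invariant). [cite: DiPernaLions1989, §II.1 (12)–(14)] [cite: Grafakos2014, §3.1 (translation on the torus)] -/
theorem translate (h : IsWeakTensorPassiveVectorForcedOn A T 𝔸 b g F w₀ w) (a : UnitAddTorus d) :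
    IsWeakTensorPassiveVectorForcedOn A T 𝔸 (fun t x => b t (x + a)) (fun t x => g t (x + a))
      (fun j t x => F j t (x + a)) (fun x => w₀ (x + a)) (fun t x => w t (x + a)) where
  aestronglyMeasurable := by
    rw [FunctionSpaces.Torus.stLift_translate]
    exact h.aestronglyMeasurable.comp_measurePreserving
      (FunctionSpaces.Torus.measurePreserving_prod_add_right measurableSet_Ioo _)
  aestronglyMeasurable_carrier := by
    rw [FunctionSpaces.Torus.stLift_translate]
    exact h.aestronglyMeasurable_carrier.comp_measurePreserving
      (FunctionSpaces.Torus.measurePreserving_prod_add_right measurableSet_Ioo _)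
  ae_lintegral_sq_le := by
    obtain ⟨C, hC⟩ := h.ae_lintegral_sq_le
    refine ⟨C, ?_⟩
    filter_upwards [hC] with t ht
    rwa [lintegral_add_right_eq_self (μ := (volume : Measure (UnitAddTorus d))) (fun x => ‖w t x‖ₑ ^ 2) a]
  lintegral_carrier_lt_top := by
    have e : ∀ t, ∫⁻ x, ‖b t (x + a)‖ₑ ^ 2 = ∫⁻ x, ‖b t x‖ₑ ^ 2 := fun t =>
      lintegral_add_right_eq_self (μ := (volume : Measure (UnitAddTorus d))) (fun x => ‖b t x‖ₑ ^ 2) a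
    simp_rw [e]
    exact h.lintegral_carrier_lt_top
  lintegral_mul_lt_top := by
    have e : ∀ t, ∫⁻ x, ‖b t (x + a)‖ₑ * ‖w t (x + a)‖ₑ = ∫⁻ x, ‖b t x‖ₑ * ‖w t x‖ₑ := fun t =>
      lintegral_add_right_eq_self (μ := (volume : Measure (UnitAddTorus d))) (fun x => ‖b t x‖ₑ * ‖w t x‖ₑ) a
    simp_rw [e]
    exact h.lintegral_mul_lt_top
  ae_isWeaklyDivFree_carrier := by
    filter_upwards [h.ae_isWeaklyDivFree_carrier] with t ht
    exact ht.translate a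
  ae_isWeaklyDivFree := by
    filter_upwards [h.ae_isWeaklyDivFree] with t ht
    exact ht.translate a
  aestronglyMeasurable_force := by
    rw [FunctionSpaces.Torus.stLift_translate]
    exact h.aestronglyMeasurable_force.comp_measurePreserving
      (FunctionSpaces.Torus.measurePreserving_prod_add_right measurableSet_Ioo _)
  lintegral_force_sq_lt_top := by
    have e : ∀ t, ∫⁻ x, ‖g t (x + a)‖ₑ ^ 2 = ∫⁻ x, ‖g t x‖ₑ ^ 2 := fun t =>
      lintegral_add_right_eq_self (μ := (volume : Measure (UnitAddTorus d))) (fun x => ‖g t x‖ₑ ^ 2) a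
    simp_rw [e]
    exact h.lintegral_force_sq_lt_top
  aestronglyMeasurable_flux j := by
    rw [FunctionSpaces.Torus.stLift_translate]
    exact (h.aestronglyMeasurable_flux j).comp_measurePreserving
      (FunctionSpaces.Torus.measurePreserving_prod_add_right measurableSet_Ioo _)
  lintegral_flux_sq_lt_top j := by
    have e : ∀ t, ∫⁻ x, ‖F j t (x + a)‖ₑ ^ 2 = ∫⁻ x, ‖F j t x‖ₑ ^ 2 := fun t =>
      lintegral_add_right_eq_self (μ := (volume : Measure (UnitAddTorus d))) (fun x => ‖F j t x‖ₑ ^ 2) a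
    simp_rw [e]
    exact h.lintegral_flux_sq_lt_top j
  weak_eq Ψ hΨ hΨdiv := by
    set Ψ' : ℝ → UnitAddTorus d → EuclideanSpace ℝ d := fun t x => Ψ t (x + -a) with hΨ'_def
    have hΨ' : FunctionSpaces.Torus.IsSpaceTimeTest T Ψ' := hΨ.translate (-a)
    have hΨ'div : ∀ t, FunctionSpaces.Torus.IsDivFree (Ψ' t) := fun t => (hΨdiv t).translate (-a)
    have key := h.weak_eq Ψ' hΨ' hΨ'div
    have hsp : ∀ t, (∫ x, (⟪w t x, FunctionSpaces.Torus.timeDeriv Ψ' t x +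
          FunctionSpaces.Torus.convect (b t) (Ψ' t) x + viscAdj 𝔸 (Ψ' t) x⟫_ℝ +
        A * ⟪b t x, FunctionSpaces.Torus.convect (w t) (Ψ' t) x⟫_ℝ)) =
        ∫ x, (⟪w t (x + a), FunctionSpaces.Torus.timeDeriv Ψ t x +
          FunctionSpaces.Torus.convect (fun y => b t (y + a)) (Ψ t) x + viscAdj 𝔸 (Ψ t) x⟫_ℝ +
        A * ⟪b t (x + a), FunctionSpaces.Torus.convect (fun y => w t (y + a)) (Ψ t) x⟫_ℝ) := by
      intro t
      rw [← integral_add_right_eq_self _ a]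
      refine integral_congr_ae (Eventually.of_forall fun x => ?_)
      have e1 : FunctionSpaces.Torus.timeDeriv Ψ' t (x + a) = FunctionSpaces.Torus.timeDeriv Ψ t x := by
        rw [hΨ'_def, FunctionSpaces.Torus.timeDeriv_translate, add_neg_cancel_right]
      have e2 : FunctionSpaces.Torus.convect (b t) (Ψ' t) (x + a) =
          FunctionSpaces.Torus.convect (fun y => b t (y + a)) (Ψ t) x := by
        simp only [hΨ'_def, FunctionSpaces.Torus.convect]
        rw [FunctionSpaces.Torus.fderiv_translate, add_neg_cancel_right]
      have e3 : viscAdj 𝔸 (Ψ' t) (x + a) = viscAdj 𝔸 (Ψ t) x := by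
        rw [hΨ'_def, viscAdj_translate, add_neg_cancel_right]
      have e4 : FunctionSpaces.Torus.convect (w t) (Ψ' t) (x + a) =
          FunctionSpaces.Torus.convect (fun y => w t (y + a)) (Ψ t) x := by
        simp only [hΨ'_def, FunctionSpaces.Torus.convect]
        rw [FunctionSpaces.Torus.fderiv_translate, add_neg_cancel_right]
      simp only [e1, e2, e3, e4]
    have hspF : ∀ t, (∫ x, (⟪g t x, Ψ' t x⟫_ℝ -
          ∑ j, ⟪F j t x, FunctionSpaces.Torus.partialDeriv j (Ψ' t) x⟫_ℝ)) =
        ∫ x, (⟪g t (x + a), Ψ t x⟫_ℝ -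
          ∑ j, ⟪F j t (x + a), FunctionSpaces.Torus.partialDeriv j (Ψ t) x⟫_ℝ) := by
      intro t
      rw [← integral_add_right_eq_self _ a]
      refine integral_congr_ae (Eventually.of_forall fun x => ?_)
      have e1 : Ψ' t (x + a) = Ψ t x := by simp only [hΨ'_def, add_neg_cancel_right]
      have e2 : ∀ j, FunctionSpaces.Torus.partialDeriv j (Ψ' t) (x + a) = FunctionSpaces.Torus.partialDeriv j (Ψ t) x := by
        intro j
        rw [hΨ'_def, FunctionSpaces.Torus.partialDeriv_translate, add_neg_cancel_right]
      simp only [e1, e2]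
    have hd : ∫ x, ⟪w₀ x, Ψ' 0 x⟫_ℝ = ∫ x, ⟪w₀ (x + a), Ψ 0 x⟫_ℝ := by
      rw [← integral_add_right_eq_self _ a]
      refine integral_congr_ae (Eventually.of_forall fun x => ?_)
      simp only [hΨ'_def, add_neg_cancel_right]
    simp_rw [hsp, hspF] at key
    rw [hd] at key
    exact key

end IsWeakTensorPassiveVectorForcedOn

end Torus

end Literature.Analysis.FluidPDE

end
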